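import Literature.MathematicalPhysics.QuantumFieldTheory.Balaban1983to89.B6QGQCoerciveMultiLevelBoxL0
import Literature.MathematicalPhysics.QuantumFieldTheory.Balaban1983to89.B4Sect5Torus
import Literature.MathematicalPhysics.QuantumFieldTheory.Balaban1983to89.B6Geom246MultiLevelBoxL0
import Literature.MathematicalPhysics.QuantumFieldTheory.Balaban1983to89.B6Ineq268MultiLevelBoxL0
import Literature.MathematicalPhysics.QuantumFieldTheory.Balaban1983to89.B6MultiLevelBoxOperatorL0
import Literature.MathematicalPhysics.QuantumFieldTheory.Balaban1983to89.B6Ineq281MultiLevelBox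

/-!
# `Balaban1983to89.B6Ineq281MultiLevelBoxL0` — LEVEL-0 TWIN (programme G-F3′-L0, director-ym LINE №27 / UV3-NODE §24.5; plan `lit-balaban-r03/G-F3L0-PLAN.md`) of `B6Ineq281MultiLevelBox`:
the same declarations, SAME NAMES AND STATEMENTS, for nested families WITH print's region `Λ₀ = T ∖ Ω₁` ADMITTED (structures
`B6MultiLevelBoxOperatorL0.Domains` / `B6MultiLevelTorusOperatorL0.TDomains`: levels `0, …, k`, the level-`0` block a single site, `Q′₀ = id`,
finite weight `a₀` — print p.225 (2.14) «Σ_{j=0}^k … (Q′₀λ)(x) = λ(x), x ∈ Λ₀», p.229 «taking a sequence (2.1) … smallest possible domains B^j(Λ_j),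
and considering the operator Δ_a defined by (2.19), (2.20) for this sequence»).  Every `D`-free object is the lineage's, consumed BY NAME; no existing
module is touched; no fact is minted.  Unit `lit-balaban-r03` (B6 fold owner, r03 gen 36); referee ref-4.  THE TWIN'S DOCUMENTATION FOLLOWS
VERBATIM (its «levels 1 … k» / «Ω₁ = X» sentences describe the twin; here `j` runs from `0` and `Ω₁` may be a proper subset).

# `Balaban1983to89.B6Ineq281MultiLevelBox` — [B6] (2.70), (2.78)–(2.81) FOR THE GENUINE `k`-LEVEL OPERATOR ON A BOX:
the cube inverses `C_□ = ((Q′G′²Q′*)↾□)⁻¹` of print's FIRST prescription (p. 235 «taking inverses of the localized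
operators (Q′G′²Q′*)↾□»), for `G′ = Δ′_a⁻¹` of an ARBITRARY nested family (2.1)–(2.2) on a Neumann box and an ARBITRARY
set of blocks `□ ⊂ 𝔅` on two adjacent levels: existence, the operator identity `(□X□)C_□ = □` behind (2.70)/(2.82), and the
decay `|C_□(y, y′)| ≤ O(1)(L^jη)^{−d−4}e^{−δ₁d(y,y′)}` (2.81) by «the theory developed in Sect. 5 [3]» — uniformly in
`k`, the family and the cube (file 3 of the `k`-level Proposition 2.3 programme of seat p21; no existing module is
touched; no fact is minted)

FRAMING (verbatim cell line):
statement-level skeleton of published theorems with citation tags; proofs where landed; nothing here is a claim about the Yang–Mills mass gap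

Source under audit (cell pub-balaban / lit-balaban): T. Bałaban, *Propagators and renormalization transformations for
lattice gauge theories. II*, Commun. Math. Phys. **96** (1984) 223–250 [`Balaban1984PropagatorsII`, "B6"], pp. 235–237
[PDF 13–15] (2.70)–(2.81) (held text `paper:balaban1984-cmp96-propagators-rt-ii` p0013–p0015, read this generation);
T. Bałaban, *Regularity and decay of lattice Green's functions*, Commun. Math. Phys. **89** (1983) 571–597
[`Balaban1983RegularityDecay`, "[3]"], Sect. 5 (5.6)–(5.7).  Unit `lit-balaban-p21` (Phase-2 proof seat p21 gen 13), HOME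
`run/shared/lean/pub/lit-balaban/`, free-target protocol G.5-34(d), B6 fold owner r03, referee ref-4.

## WHAT IS PRINTED (pp. 235–237, verbatim up to notation)

«The approximate inverse can be constructed by taking inverses of the localized operators (Q′G′²Q′*)↾□ and glueing
them together by the decomposition of unity {h_□}. … C_□ = ((Q′G′(□̃)²Q′*)↾□)⁻¹, C = Σ_□ h_□C_□h_□. (2.70) At first let us
find bounds on C_□. We assume that either □̃ ⊂ B^j(Λ_j), or it intersects B^{j+1}(Λ_{j+1}) also. …» (p. 235);
p. 236, last display: «The inequalities (2.73) and (2.77) together with the equalities (2.71) and (2.72) imply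
⟨ω, Q′G′^ξ(□̃)²Q′*ω⟩ ≥ γ₀²‖ω₁‖² = γ₀²‖Q″*ω‖² ≥ γ₀²‖ω‖². (2.78)»; p. 237 (render `…-p015-x2.png`, re-read 2026-08-22 for
v1.1): «Of course we have also a bound from above and an exponential decay of the kernel of Q′G′^ξ(□̃)²Q′* with the
decay rate δ₀. Hence the operator C^ξ_□ is bounded from above and below by absolute constants. We can use the theory
developed in Sect. 5 [3] to conclude that it has an exponential decay with a decay rate δ₁ depending on δ₀ and the
bound γ₀. Another way to prove it is to consider the operator e^{⟨a,·⟩}Q′G′^ξ(□̃)²Q′*e^{−⟨a,·⟩}, and to prove that it is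
almost equal to the operator without the exponential functions, the difference being of the order O(|a|), for a small
vector a ∈ R^d. This gives a bound for this operator almost the same as (2.78), which implies an exponential decay.
Thus we have |C^ξ_□(y, y′)| ≤ O(1)e^{−δ₁|y−y′|} (2.79) for y, y′ belonging to 𝔅 ∩ □ rescaled to unit scale. From (2.71)
we obtain the following scaling law for the operators C_□: C_□(y, y′) = (L^jη)^{−d−4}C^ξ_□((L^jη)^{−1}y, (L^jη)^{−1}y′),
(2.80) hence |C_□(y, y′)| ≤ O(1)(L^jη)^{−d−4}e^{−δ₁(L^jη)^{−1}|y−y′|}, y, y′ ∈ 𝔅 ∩ □. (2.81)»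

READING (ours, not printed — v1.1 moves this sentence out of the verbatim block, referee ref-1 g67 ask): the «bound from
above and an exponential decay of the kernel … with the decay rate δ₀» of p. 237 is, for the first prescription used
here (`X̃_□ := Q′G′²Q′*`, HONEST SCOPE), exactly the (2.68)-shape entry bound of file 1 with the scaled distance
`d(y, y′)`; together with the coercivity (2.78) it is the input pair of «the theory developed in Sect. 5 [3]» (§§2–3
below).  v1.0 of this header paraphrased that step inside the quotation marks; the typed statements are unchanged.

## WHAT THIS FILE CERTIFIES (kernel-checked; setting of `B6Ineq268MultiLevelBox` / `B6QGQCoerciveMultiLevelBox`)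

For every nested family `D` on the fine box (lattice units, spatial dimension `d + 1`), windowed weights, the genuine
`k`-level `G′ = gml`, the (2.69)-kernel `X = Xk` of `Q′G′²Q′*` (file 1) and every finite set of blocks `Q ⊂ 𝔅` («𝔅 ∩ □»)
lying on two adjacent levels `j_s, j_s + 1`:
* §1 `⟨f, Q′G′²Q′*g⟩_{(2.69)} = ⟨G′Q′*f, G′Q′*g⟩` (`wform_Xk`, the identity behind (2.72)) and the symmetry of `X`;
* §2 the conjugated kernel `B = Λ⁻²W^{½}·X·W^{½}Λ⁻²` (`Bm`; `Λ = diag(L^j)`, `W = diag((L^j)^{d+1})`): symmetric, its Euclidean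
  form is `‖G′Q′*g‖²` at `g = W^{−½}Λ⁻²z` (`Bm_form`), hence **coercive with `γ_B = C_E⁻²/L²` on every two-level window**
  ((2.78), from `qggq_coercive_window` of file 2; `Bm_coercive_window`), with entries
  `|B(y, y′)| ≤ C·L^{d+3}·e^{−(δ₀/8)d(y,y′)}` ((2.68) of file 1 plus (2.60): the level ratios `L^{(d+3)|j−j′|}` are absorbed by
  `e^{−(δ₀/8)d}` under `L^{d+3} ≤ e^{(δ₀/8)(RM−1)}`; `Bm_entry_le`);
* §3 [3] Sect. 5 (5.6) ⇒ (5.7) for the compression of `B` to `Q` (`B4Sect5Torus.inv_decay`, with the (2.61) profile of the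
  box): `|(B↾Q)⁻¹(y, y′)| ≤ (2/γ_B)e^{−δ₁d(y,y′)}`, `δ₁ = rate(profile, γ_B, CL^{d+3}, δ₀/8)` (`invBQ_decay`);
* §4 **THE CUBE INVERSE (2.70)**: `C_□` (`CkQ`, the (2.69)-kernel of `Λ⁻²W^{−½}(B↾Q)⁻¹W^{½}Λ⁻²` extended by zero) vanishes
  off `□` (`CkQ_off`), satisfies the operator identity `□·Q′G′²Q′*·□·C_□ = □` (`loc_mul_CkQ`; with `□h_□ = h_□` this is the
  input `h270` of the Prop. 2.3 assembly), and **(2.81)**: `|C_□(y, y′)| ≤ (2/γ_B)·(L^{j_s})^{−(d+1)−4}·e^{−δ₁d(y,y′)}` on `□`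
  (`CkQ_decay`);
* §5 the package over the family with explicit thresholds (`ineq281_multiLevelBox`): `∃ δ₁ B_C M₀ N₀ > 0 ∀ k, M_h, R, P, D`,
  weights, `∀ Q` two-level: the three facts above — the inputs `h281`, `hCk0`, `h270` of
  `B6Prop23TwoLevel.prop23_assembled_twoLevel` on genuine objects.

## HONEST SCOPE

* First prescription of p. 235 (`X̃_□ := X = Q′G′²Q′*`, no change of domain), as in p01's one-scale
  `B6Expansion286TowerTorus`; the MODIFIED prescription with `G′(□̃)` (p. 235 «We change this prescription a little bit»)
  is not constructed here.
* (2.79)'s route «the theory developed in Sect. 5 [3]» is the tree's generalised (5.6) ⇒ (5.7) over a pseudo-distance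
  (`B4Sect5Torus`), applied to the conjugated kernel; the conjugation by `Λ⁻²W^{½}` is print's rescaling (2.71)/(2.80) to the
  `ξ = L^{−j}` lattice written in `η`-units (two adjacent levels cost the factor `L²` in `γ_B`).
* Neumann box, levels `1 … k`, `A = 0`, lattice units; constants explicit, not optimised; the cube `Q` is any two-level set
  of blocks (the cover's cubes are chosen in the next file).
* Nothing is inferred from the manuscript: every step is kernel-checked; the quoted sentences locate the statements.
-/

namespace Literature.MathematicalPhysics.QuantumFieldTheory.Balaban1983to89.B6Ineq281MultiLevelBoxL0

open Finset Matrix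
open Literature.MathematicalPhysics.QuantumFieldTheory.Balaban1983to89.B4Reflection242 (boxDom)
open Literature.MathematicalPhysics.QuantumFieldTheory.Balaban1983to89.B6MultiLevelBoxOperator hiding Domains mlOp_apply
open Literature.MathematicalPhysics.QuantumFieldTheory.Balaban1983to89.B6MultiLevelBoxOperatorL0
open Literature.MathematicalPhysics.QuantumFieldTheory.Balaban1983to89.B6Geom246MultiLevelBox hiding Touch blkOf blkOf_corner blkOf_eq_iff_blk blkOf_eq_of_blk_i_eq blkOf_val bond bond_adj bset cen connected coord_bounds corner corner_mem csys dist_blkOf_le_box dist_blkOf_le_coord dist_blkOf_le_line dist_cen_le_of_adj dist_cen_le_of_touch dist_le_one_of_near dist_toR_cen_le exists_blkOf_eq geom lemma21_box lev_corner lev_eq_of_blkOf_eq levelGap pack reachable_blkOf reachable_of_near realizes scale_bounds touch_symm triangle_refl_nonneg walk_disp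
open Literature.MathematicalPhysics.QuantumFieldTheory.Balaban1983to89.B6Geom246MultiLevelBoxL0
open Literature.MathematicalPhysics.QuantumFieldTheory.Balaban1983to89.B6Ineq268MultiLevelBox hiding QB QB_apply QsB QsB_apply W W_eq W_pos Xk abs_qB abs_qB_le card_blkOf_le csysB geomB geomB_L geomB_M geomB_R geomB_RM geomB_RM_nonneg geomB_Site geomB_dist geomB_eta geomB_len geom_len ineq268_multiLevelBox instDecidableEqGeomBSite kerOp_Xk levelSepB qB qB_ne_zero realizesB refl_nonnegB sum_abs_qB_le symmB triangleB
open Literature.MathematicalPhysics.QuantumFieldTheory.Balaban1983to89.B6Ineq268MultiLevelBoxL0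
open Literature.MathematicalPhysics.QuantumFieldTheory.Balaban1983to89.B6QGQCoerciveMultiLevelBox hiding QsB_dot_QsB Sw Sw_nonneg W_eq_nb_pow abs_bump_sub_le avgForm_eq blkOf_siteOf blk_eq_iff_blkOf_eq block_fits bond_sq_le bump bump_face_le bump_le bump_nonneg card_blkOf_eq energy_le face_of_nbr filter_blkOf_eq_image form_eq lapForm_le nb nb_cast offOf one_le_nb phi qggq_coercive_window qggq_lower_multiLevelBox qgq_coercive_multiLevelBox siteOf siteOf_offOf sum_blockFun sum_bump_fiber sum_fiber_eq_sum_chart sum_phi sum_testV_fiber testV testV_dot_QsB testV_sq_le_of_face testV_sub_sq_le_of_same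
open Literature.MathematicalPhysics.QuantumFieldTheory.Balaban1983to89.B6QGQCoerciveMultiLevelBoxL0
open Literature.MathematicalPhysics.QuantumFieldTheory.Balaban1983to89.B6Ineq2142 (avgOp avgAdj kernelW avgOp_apply)
open Literature.MathematicalPhysics.QuantumFieldTheory.Balaban1983to89.B6Ineq243TwoLevelBox (aNext)
open Literature.MathematicalPhysics.QuantumFieldTheory.Balaban1983to89.B6Expansion282 (kerOp mulOp kerOp_apply
  mulOp_apply)
open Literature.MathematicalPhysics.QuantumFieldTheory.Balaban1983to89.B6Prop23Chain (mat)
open Literature.MathematicalPhysics.QuantumFieldTheory.Balaban1983to89.B4Sect5Torus (IsPseudoDist SumBound Hyp56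
  rate inv_decay isUnit_of_hyp56 sum_eq_sum_range rate_pos)
open Literature.MathematicalPhysics.QuantumFieldTheory.Balaban1983to89.B6Ineq261LevelGap (K261 K261_nonneg
  theta_lt_one_of_log)
open Literature.MathematicalPhysics.QuantumFieldTheory.Balaban1983to89.B6Ineq281MultiLevelBox (hyp56_submatrix_window Kprof rate_Kprof)

noncomputable section

variable {d : ℕ}

/-! ## §1 The `(2.69)`-form of `Q′G′²Q′*` and the symmetry of its kernel -/

section Form

variable {ℓ Mh k R : ℕ} {P : Fin (d + 1) → ℕ} (D : Domains d ℓ Mh k P R) (a : ℕ → ℝ)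

/-- shorthand: the genuine `k`-level `G′` as a matrix. [cite: Balaban1984PropagatorsII, p.225 («G′ = Δ′_a^{−1}»)] -/
abbrev Gm : Matrix ↥(boxDom (N0 ℓ Mh k P)) ↥(boxDom (N0 ℓ Mh k P)) ℝ := gml (N0 ℓ Mh k P) ℓ k D.lev a

/-- `Σ_y W(y)·f(y)·q(y, x) = f(y(x))` (the adjoint `Q′*` once more). [cite: Balaban1984PropagatorsII, (2.69) p.235, dictionary] -/
theorem sum_W_mul_qB (f : ↥(B6Geom246MultiLevelBoxL0.bset D) → ℝ) (x : ↥(boxDom (N0 ℓ Mh k P))) :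
    ∑ y, W D y * f y * qB D y x = f (blkOf D x) := by
  have h := QsB_apply D f x
  unfold QsB at h
  change (1 : ℝ)⁻¹ * ∑ b, W D b * qB D b x * f b = f (blkOf D x) at h
  rw [inv_one, one_mul] at h
  rw [← h]
  exact Finset.sum_congr rfl fun y _ => by ring

/-- **`⟨f, Q′G′²Q′*g⟩_{(2.69)} = ⟨G′Q′*f, G′Q′*g⟩`** — the identity behind (2.72) «= ‖G′Q′*ω‖²» (symmetry of `G′`,
adjointness of `Q′`, `Q′*`). [cite: Balaban1984PropagatorsII, (2.72) p.236, (2.69) p.235] -/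
theorem wform_Xk (f g : ↥(bset D) → ℝ) :
    ∑ y, W D y * f y * (kerOp (W D) (Xk D a) g) y = (Gm D a *ᵥ QsB D f) ⬝ᵥ (Gm D a *ᵥ QsB D g) := by
  rw [kerOp_Xk]
  simp only [LinearMap.comp_apply, Matrix.toLin'_apply]
  set u : ↥(boxDom (N0 ℓ Mh k P)) → ℝ := Gm D a *ᵥ (Gm D a *ᵥ QsB D g) with hu
  -- `Σ_y W f (Q′u)(y) = Σ_x f(y(x)) u(x) = ⟨Q′*f, u⟩`
  have h1 : ∑ y, W D y * f y * (QB D) u y = ∑ x, f (blkOf D x) * u x := by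
    unfold QB
    simp only [avgOp_apply, Finset.mul_sum]
    rw [Finset.sum_comm]
    refine Finset.sum_congr rfl fun x _ => ?_
    rw [← sum_W_mul_qB D f x, Finset.sum_mul]
    exact Finset.sum_congr rfl fun y _ => by ring
  rw [h1]
  have h2 : ∑ x, f (blkOf D x) * u x = QsB D f ⬝ᵥ u := by
    unfold dotProduct; exact Finset.sum_congr rfl fun x _ => by rw [QsB_apply]
  rw [h2, hu, Matrix.dotProduct_mulVec, ← Matrix.mulVec_transpose, (gml_isSymm (N := N0 ℓ Mh k P) (ℓ := ℓ)
    (k := k) (lev := D.lev) (a := a)).eq]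

/-- **the kernel `X` of `Q′G′²Q′*` is symmetric** (`Q′G′²Q′*` is self-adjoint for (2.69)). [cite: Balaban1984PropagatorsII, (2.69) p.235, (2.72) p.236] -/
theorem Xk_symm (y y' : ↥(B6Geom246MultiLevelBoxL0.bset D)) : Xk D a y y' = Xk D a y' y := by
  classical
  -- `W(y)W(y′)X(y,y′) = ⟨δ_y, Q′G′²Q′*δ_{y′}⟩_W` is symmetric
  have key : ∀ u v : ↥(bset D), W D u * W D v * Xk D a u v =
      (Gm D a *ᵥ QsB D (Pi.single u 1)) ⬝ᵥ (Gm D a *ᵥ QsB D (Pi.single v 1)) := by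
    intro u v
    rw [← wform_Xk D a (Pi.single u 1) (Pi.single v 1)]
    rw [Finset.sum_eq_single u]
    · rw [Pi.single_eq_same, mul_one]
      have hX : (kerOp (W D) (Xk D a)) (Pi.single v 1) u = mat (kerOp (W D) (Xk D a)) u v := rfl
      rw [hX, B6Prop23Chain.mat_kerOp]; ring
    · intro b _ hb; rw [Pi.single_eq_of_ne hb]; ring
    · intro h; exact absurd (Finset.mem_univ u) h
  have h := key y y'
  rw [dotProduct_comm, ← key y' y] at h
  have hW : W D y * W D y' ≠ 0 := mul_ne_zero (W_pos D y).ne' (W_pos D y').ne'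
  have : W D y * W D y' * Xk D a y y' = W D y * W D y' * Xk D a y' y := by linarith
  exact mul_left_cancel₀ hW this

end Form

/-! ## §2 The conjugated kernel `B = Λ⁻²W^{½}XW^{½}Λ⁻²`: symmetry, coercivity on two-level windows, entries -/

section Conjugate

variable {ℓ Mh k R : ℕ} {P : Fin (d + 1) → ℕ} (D : Domains d ℓ Mh k P R) (a : ℕ → ℝ)

/-- `m(y) = W(y)^{½} = (L^j)^{(d+1)/2}`. [cite: Balaban1984PropagatorsII, (2.71)/(2.80) p.235–237 (rescaling), bookkeeping] -/
def mW (y : ↥(bset D)) : ℝ := Real.sqrt (W D y)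

/-- `m(y) > 0`. [folklore] -/
private theorem mW_pos (y : ↥(bset D)) : 0 < mW D y := Real.sqrt_pos.2 (W_pos D y)

/-- `m(y)² = W(y)`. [folklore] -/
private theorem mW_sq (y : ↥(bset D)) : mW D y ^ 2 = W D y := Real.sq_sqrt (W_pos D y).le

/-- `n(y) > 0` as a real. [folklore] -/
private theorem nbR_pos (y : ↥(bset D)) : (0 : ℝ) < ((nb D y : ℕ) : ℝ) := by exact_mod_cast one_le_nb D y

/-- the conjugation weight `c(y) = m(y)/(L^j)²`. [cite: Balaban1984PropagatorsII, (2.80) p.237, bookkeeping] -/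
def cw (y : ↥(bset D)) : ℝ := mW D y / ((nb D y : ℕ) : ℝ) ^ 2

/-- `c(y) > 0`. [folklore] -/
private theorem cw_pos (y : ↥(bset D)) : 0 < cw D y := div_pos (mW_pos D y) (pow_pos (nbR_pos D y) 2)

/-- **the conjugated kernel** `B(y, y′) = c(y)·X(y, y′)·c(y′)`, `c = W^{½}Λ⁻²` — print's `(Q′G′^ξ(□̃)²Q′*)` on the
`ξ = L^{−j}` lattice in `η`-units, symmetrised for [3] Sect. 5. [cite: Balaban1984PropagatorsII, (2.71) p.235, (2.80) p.237] -/
def Bm : Matrix ↥(bset D) ↥(bset D) ℝ := fun y y' => cw D y * Xk D a y y' * cw D y'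

/-- `B` is symmetric. [cite: Balaban1984PropagatorsII, (2.69) p.235 (self-adjointness)] -/
theorem Bm_isSymm : (Bm D a).IsSymm := by
  ext y y'
  simp only [Matrix.transpose_apply, Bm]
  rw [Xk_symm D a y' y]; ring

/-- **the Euclidean form of `B` is `‖G′Q′*g‖²`** at `g = c·z/W`: `zᵀBz = ⟨g, Q′G′²Q′*g⟩_{(2.69)} = ‖G′Q′*g‖²`.
[cite: Balaban1984PropagatorsII, (2.72) p.236, (2.78) p.236] -/
theorem Bm_form (z : ↥(bset D) → ℝ) :
    z ⬝ᵥ (Bm D a *ᵥ z) =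
      (Gm D a *ᵥ QsB D (fun y => cw D y / W D y * z y)) ⬝ᵥ (Gm D a *ᵥ QsB D (fun y => cw D y / W D y * z y)) := by
  rw [← wform_Xk]
  simp only [dotProduct, Matrix.mulVec, Bm, kerOp_apply, Finset.mul_sum]
  refine Finset.sum_congr rfl fun y _ => Finset.sum_congr rfl fun y' _ => ?_
  have hW := (W_pos D y).ne'
  have hW' := (W_pos D y').ne'
  field_simp

/-- **(2.78) FOR `B`: coercivity on every two-level window**: if `z` is carried by blocks of levels `j_s, j_s + 1` then
`zᵀBz ≥ γ_B‖z‖²`, `γ_B = C_E⁻²/L²` — uniformly in `k`, the family and the window. [cite: Balaban1984PropagatorsII, (2.78) p.236] -/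
theorem Bm_coercive_window (hMh : 1 ≤ Mh) (hP : ∀ μ, 1 ≤ P μ) {aplus : ℝ} (ha : ∀ j, 0 < a j)
    (hale : ∀ j, a j ≤ aplus) (js : ℕ) (z : ↥(bset D) → ℝ)
    (hz : ∀ y, z y ≠ 0 → js ≤ y.1.1 ∧ y.1.1 ≤ js + 1) :
    (CE d aplus)⁻¹ ^ 2 / ((ℓ : ℝ) + 1) ^ 2 * ∑ y, z y ^ 2 ≤ z ⬝ᵥ (Bm D a *ᵥ z) := by
  rw [Bm_form]
  set g : ↥(bset D) → ℝ := fun y => cw D y / W D y * z y with hg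
  have hgz : ∀ y, g y ≠ 0 → js ≤ y.1.1 ∧ y.1.1 ≤ js + 1 := by
    intro y hy; apply hz y; intro h; apply hy; rw [hg]; dsimp only; rw [h, mul_zero]
  have h := qggq_coercive_window D hMh hP ha hale g js hgz
  have hsum : ∑ y, W D y * ((nb D y : ℕ) : ℝ) ^ 4 * g y ^ 2 = ∑ y, z y ^ 2 := by
    refine Finset.sum_congr rfl fun y _ => ?_
    rw [hg]; dsimp only
    have hn := (nbR_pos D y).ne'
    have hm0 := (mW_pos D y).ne'
    rw [← mW_sq D y]
    unfold cw
    field_simp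
  rw [hsum] at h
  exact h

/-- the level gap as a natural number: `|j − j′|`. [cite: Balaban1984PropagatorsII, (2.60) p.234, dictionary] -/
def lgap (y y' : ↥(bset D)) : ℕ := Int.natAbs ((y.1.1 : ℤ) - y'.1.1)

/-- `max{|j − j′| − 1, 0} = |j − j′| − 1` (truncated) as a real. [cite: Balaban1984PropagatorsII, (2.60) p.234, dictionary] -/
theorem mx_eq_lgap (y y' : ↥(bset D)) : B6Ineq268.mx (geomB D) y y' = ((lgap D y y' - 1 : ℕ) : ℝ) := by
  unfold B6Ineq268.mx lgap
  have hscale : ∀ z : ↥(bset D), ((geomB D).scale z : ℝ) = (z.1.1 : ℝ) := fun z => rfl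
  rw [hscale, hscale]
  have habs : |(y.1.1 : ℝ) - y'.1.1| = ((Int.natAbs ((y.1.1 : ℤ) - y'.1.1) : ℕ) : ℝ) := by
    rw [Nat.cast_natAbs]; push_cast; rfl
  rw [habs]
  rcases Nat.eq_zero_or_pos (Int.natAbs ((y.1.1 : ℤ) - y'.1.1)) with h0 | h0
  · rw [h0]; simp
  · have h1 : (1 : ℝ) ≤ ((Int.natAbs ((y.1.1 : ℤ) - y'.1.1) : ℕ) : ℝ) := by exact_mod_cast h0
    rw [Nat.cast_sub h0, max_eq_left (by linarith)]
    push_cast; ring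

/-- the level ratio `(n(y)/n(y′))²·(m(y)/m(y′)) ≤ (L^{d+3})^{|j−j′|}`. [cite: Balaban1984PropagatorsII, (2.68) p.235 (the factors L^{2(j″−j)}), bookkeeping] -/
theorem ratio_le (hℓ : 1 ≤ ℓ) (y y' : ↥(bset D)) :
    (((nb D y : ℕ) : ℝ) / ((nb D y' : ℕ) : ℝ)) ^ 2 * (mW D y / mW D y')
      ≤ (((ℓ : ℝ) + 1) ^ (d + 3)) ^ lgap D y y' := by
  have hL1 : (1 : ℝ) ≤ (ℓ : ℝ) + 1 := by linarith [(Nat.cast_nonneg ℓ : (0 : ℝ) ≤ ℓ)]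
  have hL0 : (0 : ℝ) < (ℓ : ℝ) + 1 := by positivity
  set t : ℝ := ((nb D y : ℕ) : ℝ) / ((nb D y' : ℕ) : ℝ) with ht
  have ht0 : 0 < t := div_pos (nbR_pos D y) (nbR_pos D y')
  -- `m(y)/m(y′) = √(t^{d+1})`
  have hm : mW D y / mW D y' = Real.sqrt (t ^ (d + 1)) := by
    unfold mW
    rw [← Real.sqrt_div' _ (W_pos D y').le, W_eq_nb_pow, W_eq_nb_pow, ← div_pow]
  rw [hm]
  -- `t = L^{j}/L^{j′} ≤ L^{|j−j′|}` and `t ≥ 0`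
  have htL : t ≤ ((ℓ : ℝ) + 1) ^ lgap D y y' := by
    rw [ht]; unfold nb lgap
    push_cast
    rw [div_le_iff₀ (by positivity), ← pow_add]
    exact pow_le_pow_right₀ hL1 (by omega)
  have hpowL : (1 : ℝ) ≤ (((ℓ : ℝ) + 1) ^ (d + 3)) ^ lgap D y y' := one_le_pow₀ (one_le_pow₀ hL1)
  rcases le_or_gt t 1 with h1 | h1
  · -- `t ≤ 1`: everything is `≤ 1`
    have hs : Real.sqrt (t ^ (d + 1)) ≤ 1 := Real.sqrt_le_one.mpr (pow_le_one₀ ht0.le h1)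
    calc t ^ 2 * Real.sqrt (t ^ (d + 1)) ≤ 1 * 1 :=
          mul_le_mul (pow_le_one₀ ht0.le h1) hs (Real.sqrt_nonneg _) zero_le_one
      _ ≤ _ := by rw [one_mul]; exact hpowL
  · -- `t > 1`: `√(t^{d+1}) ≤ t^{d+1}`, so the product is `≤ t^{d+3} ≤ (L^{|Δj|})^{d+3}`
    have hge : (1 : ℝ) ≤ t ^ (d + 1) := one_le_pow₀ h1.le
    have hs : Real.sqrt (t ^ (d + 1)) ≤ t ^ (d + 1) := by
      rw [Real.sqrt_le_left (by positivity)]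
      nlinarith
    calc t ^ 2 * Real.sqrt (t ^ (d + 1)) ≤ t ^ 2 * t ^ (d + 1) := mul_le_mul_of_nonneg_left hs (by positivity)
      _ = t ^ (d + 3) := by ring
      _ ≤ (((ℓ : ℝ) + 1) ^ lgap D y y') ^ (d + 3) := pow_le_pow_left₀ ht0.le htL _
      _ = (((ℓ : ℝ) + 1) ^ (d + 3)) ^ lgap D y y' := by rw [← pow_mul, ← pow_mul, mul_comm]

/-- the absorption: `(L^p)^{n}·e^{−β·N·(n−1)} ≤ L^p` once `L^p·e^{−βN} ≤ 1` (`n − 1` truncated). [folklore] -/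
private theorem pow_absorb {Lp β N : ℝ} (hLp : 1 ≤ Lp) (hsmall : Lp * Real.exp (-(β * N)) ≤ 1) (n : ℕ) :
    Lp ^ n * Real.exp (-(β * N * ((n - 1 : ℕ) : ℝ))) ≤ Lp := by
  rcases Nat.eq_zero_or_pos n with h0 | h0
  · subst h0; simp; exact hLp
  · obtain ⟨m, rfl⟩ : ∃ m, n = m + 1 := ⟨n - 1, by omega⟩
    rw [Nat.add_sub_cancel, pow_succ, show -(β * N * (m : ℝ)) = (m : ℕ) * (-(β * N)) by ring,
      Real.exp_nat_mul]
    have h0' : 0 ≤ Lp * Real.exp (-(β * N)) := by positivity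
    calc Lp ^ m * Lp * Real.exp (-(β * N)) ^ m = Lp * (Lp * Real.exp (-(β * N))) ^ m := by rw [mul_pow]; ring
      _ ≤ Lp * 1 := mul_le_mul_of_nonneg_left (pow_le_one₀ h0' hsmall) (by linarith)
      _ = Lp := mul_one _

/-- **the entries of `B`**: from (2.68) `|X(y, y′)| ≤ C(L^j)⁴W(y′)⁻¹e^{−¼δ₀d}` and (2.60) `(RM − 1)·max{|j−j′|−1,0} ≤ d(y,y′)`,
under `L^{d+3}e^{−(δ₀/8)(RM−1)} ≤ 1`: `|B(y, y′)| ≤ C·L^{d+3}·e^{−(δ₀/8)d(y,y′)}` — uniformly in the levels.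
[cite: Balaban1984PropagatorsII, (2.68) p.235, (2.60) p.234, (2.79)–(2.80) p.237] -/
theorem Bm_entry_le (hℓ : 1 ≤ ℓ) (hMh : 1 ≤ Mh) (hP : ∀ μ, 1 ≤ P μ) (hRM : 1 ≤ R * ((ℓ + 1) * Mh)) {C δ₀ : ℝ}
    (hC : 0 ≤ C) (hδ₀ : 0 ≤ δ₀)
    (hX : ∀ y y', |Xk D a y y'| ≤ C * (geom D).len y ^ 4 * ((geom D).len y' ^ (d + 1))⁻¹ *
      Real.exp (-(δ₀ / 4 * (geom D).dist y y')))
    (hsmall : ((ℓ : ℝ) + 1) ^ (d + 3) * Real.exp (-(δ₀ / 8 * ((R : ℝ) * (((ℓ : ℝ) + 1) * Mh) - 1))) ≤ 1)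
    (y y' : ↥(bset D)) :
    |Bm D a y y'| ≤ C * ((ℓ : ℝ) + 1) ^ (d + 3) * Real.exp (-(δ₀ / 8 * (geom D).dist y y')) := by
  have hL1 : (1 : ℝ) ≤ (ℓ : ℝ) + 1 := by linarith [(Nat.cast_nonneg ℓ : (0 : ℝ) ≤ ℓ)]
  have hlen : ∀ z : ↥(bset D), (geom D).len z = ((nb D z : ℕ) : ℝ) := fun z => (nb_cast D z).symm
  have hn := nbR_pos D y
  have hn' := nbR_pos D y'
  have hm := mW_pos D y
  have hm' := mW_pos D y'
  -- `|B| = c(y)|X|c(y′) ≤ C·(n/n′)²(m/m′)·e^{−¼δ₀d}`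
  have h1 : |Bm D a y y'| ≤ C * ((((nb D y : ℕ) : ℝ) / ((nb D y' : ℕ) : ℝ)) ^ 2 * (mW D y / mW D y')) *
      Real.exp (-(δ₀ / 4 * (geom D).dist y y')) := by
    have hx := hX y y'
    rw [hlen, hlen] at hx
    have hWm : ((nb D y' : ℕ) : ℝ) ^ (d + 1) = mW D y' ^ 2 := by rw [mW_sq, W_eq_nb_pow]
    rw [hWm] at hx
    unfold Bm
    rw [abs_mul, abs_mul, abs_of_pos (cw_pos D y), abs_of_pos (cw_pos D y')]
    have hcalc : cw D y * (C * ((nb D y : ℕ) : ℝ) ^ 4 * (mW D y' ^ 2)⁻¹ *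
        Real.exp (-(δ₀ / 4 * (geom D).dist y y'))) * cw D y'
        = C * ((((nb D y : ℕ) : ℝ) / ((nb D y' : ℕ) : ℝ)) ^ 2 * (mW D y / mW D y')) *
          Real.exp (-(δ₀ / 4 * (geom D).dist y y')) := by
      unfold cw
      field_simp
    rw [← hcalc]
    exact mul_le_mul_of_nonneg_right (mul_le_mul_of_nonneg_left hx (cw_pos D y).le) (cw_pos D y').le
  -- the ratio `≤ (L^{d+3})^{|Δj|}` and the absorption by (2.60)
  have h2 := ratio_le D hℓ y y'
  have hsep := levelSepB D hMh hP hRM y y'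
  rw [geomB_RM D hMh, mx_eq_lgap] at hsep
  change ((R : ℝ) * (((ℓ : ℝ) + 1) * Mh) - 1) * ((lgap D y y' - 1 : ℕ) : ℝ) ≤ (geom D).dist y y' at hsep
  have hsplit : Real.exp (-(δ₀ / 4 * (geom D).dist y y')) =
      Real.exp (-(δ₀ / 8 * (geom D).dist y y')) * Real.exp (-(δ₀ / 8 * (geom D).dist y y')) := by
    rw [← Real.exp_add]; congr 1; ring
  have hexp2 : Real.exp (-(δ₀ / 8 * (geom D).dist y y')) ≤
      Real.exp (-(δ₀ / 8 * ((R : ℝ) * (((ℓ : ℝ) + 1) * Mh) - 1) * ((lgap D y y' - 1 : ℕ) : ℝ))) := by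
    rw [Real.exp_le_exp, neg_le_neg_iff, mul_assoc]
    exact mul_le_mul_of_nonneg_left hsep (by positivity)
  have habs := pow_absorb (Lp := ((ℓ : ℝ) + 1) ^ (d + 3)) (β := δ₀ / 8)
    (N := (R : ℝ) * (((ℓ : ℝ) + 1) * Mh) - 1) (one_le_pow₀ hL1) hsmall (lgap D y y')
  have hE0 : 0 ≤ Real.exp (-(δ₀ / 8 * (geom D).dist y y')) := (Real.exp_pos _).le
  calc |Bm D a y y'| ≤ _ := h1
    _ ≤ C * (((ℓ : ℝ) + 1) ^ (d + 3)) ^ lgap D y y' * Real.exp (-(δ₀ / 4 * (geom D).dist y y')) :=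
        mul_le_mul_of_nonneg_right (mul_le_mul_of_nonneg_left h2 hC) (Real.exp_pos _).le
    _ = C * ((((ℓ : ℝ) + 1) ^ (d + 3)) ^ lgap D y y' * Real.exp (-(δ₀ / 8 * (geom D).dist y y'))) *
          Real.exp (-(δ₀ / 8 * (geom D).dist y y')) := by rw [hsplit]; ring
    _ ≤ C * ((((ℓ : ℝ) + 1) ^ (d + 3)) ^ lgap D y y' *
          Real.exp (-(δ₀ / 8 * ((R : ℝ) * (((ℓ : ℝ) + 1) * Mh) - 1) * ((lgap D y y' - 1 : ℕ) : ℝ)))) *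
          Real.exp (-(δ₀ / 8 * (geom D).dist y y')) :=
        mul_le_mul_of_nonneg_right (mul_le_mul_of_nonneg_left
          (mul_le_mul_of_nonneg_left hexp2 (by positivity)) hC) hE0
    _ ≤ C * ((ℓ : ℝ) + 1) ^ (d + 3) * Real.exp (-(δ₀ / 8 * (geom D).dist y y')) := by
        have := mul_le_mul_of_nonneg_left habs hC
        nlinarith [hE0]

end Conjugate

/-! ## §3 [3] Sect. 5, (5.6) ⇒ (5.7), for the compression of `B` to a two-level set of blocks -/

section Sect5

variable {ℓ Mh k R : ℕ} {P : Fin (d + 1) → ℕ} (D : Domains d ℓ Mh k P R) (a : ℕ → ℝ)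

/-- the distance of the box geometry is a pseudo-distance (symmetric, zero diagonal, (2.54)).
[cite: Balaban1984PropagatorsII, (2.46) p.231, (2.54) p.233] -/
theorem isPseudoDist_dist (hMh : 1 ≤ Mh) (hP : ∀ μ, 1 ≤ P μ) : IsPseudoDist (B6Geom246MultiLevelBoxL0.geom D).dist :=
  ⟨fun y y' => B6Geometry.dist_comm_of_realizes (realizes D) y y',
   fun y => B6Geometry.dist_self_of_realizes (realizes D) y,
   fun y y' y'' => (triangle_refl_nonneg D hMh hP).1 y y' y''⟩

/-- `K ≥ 0`. [folklore] -/
private theorem Kprof_nonneg {δ₀ c : ℝ} (hc : 0 ≤ c) (card : ℕ) : ∀ t, 0 < t → 0 ≤ Kprof δ₀ c card t := by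
  intro t _; unfold Kprof; split_ifs
  · exact hc
  · exact Nat.cast_nonneg _

/-- **the profile bound `Σ_{y′} e^{−t·d(y,y′)} ≤ K(t)`** for every `t > 0`, from (2.61) at `α = 1/16`.
[cite: Balaban1984PropagatorsII, Lemma 2.1 (2.61) p.234] -/
theorem sumBound_box (hMh : 1 ≤ Mh) (hP : ∀ μ, 1 ≤ P μ) {δ₀ c : ℝ}
    (h261 : B6Lemma21Repaired.Ineq261With c (B6Geom246MultiLevelBoxL0.geom D) δ₀ (1 / 16)) :
    SumBound (geom D).dist (Kprof δ₀ c (Fintype.card ↥(bset D))) := by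
  intro t ht y
  have hd0 : ∀ y', 0 ≤ (geom D).dist y y' := (triangle_refl_nonneg D hMh hP).2.2 y
  unfold Kprof
  split_ifs with hle
  · refine le_trans (Finset.sum_le_sum fun y' _ => ?_) (h261 y)
    rw [Real.exp_le_exp]
    have := mul_le_mul_of_nonneg_right hle (hd0 y')
    linarith
  · calc ∑ y', Real.exp (-(t * (geom D).dist y y')) ≤ ∑ _y' : ↥(bset D), (1 : ℝ) :=
          Finset.sum_le_sum fun y' _ => by
            rw [Real.exp_le_one_iff, neg_nonpos]; exact mul_nonneg ht.le (hd0 y')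
      _ = Fintype.card ↥(bset D) := by simp

/-- the compression of `B` to a finite set of blocks `Q` («(·)↾□, 𝔅 ∩ □»). [cite: Balaban1984PropagatorsII, (2.70) p.235] -/
abbrev BQ (Q : Finset ↥(bset D)) : Matrix ↥Q ↥Q ℝ :=
  (Bm D a).submatrix (fun i : ↥Q => i.1) (fun i : ↥Q => i.1)

/-- **(5.6) FOR `B↾Q`**, `Q` on two adjacent levels: symmetric, coercive with `γ_B`, entries `≤ CL^{d+3}e^{−(δ₀/8)d}`.
[cite: Balaban1983RegularityDecay, (5.6) p.594; Balaban1984PropagatorsII, (2.78)–(2.79) p.236–237] -/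
theorem hyp56_BQ (hℓ : 1 ≤ ℓ) (hMh : 1 ≤ Mh) (hP : ∀ μ, 1 ≤ P μ) (hRM : 1 ≤ R * ((ℓ + 1) * Mh)) {aplus : ℝ}
    (ha : ∀ j, 0 < a j) (hale : ∀ j, a j ≤ aplus) {C δ₀ : ℝ} (hC : 0 ≤ C) (hδ₀ : 0 ≤ δ₀)
    (hX : ∀ y y', |Xk D a y y'| ≤ C * (geom D).len y ^ 4 * ((geom D).len y' ^ (d + 1))⁻¹ *
      Real.exp (-(δ₀ / 4 * (geom D).dist y y')))
    (hsmall : ((ℓ : ℝ) + 1) ^ (d + 3) * Real.exp (-(δ₀ / 8 * ((R : ℝ) * (((ℓ : ℝ) + 1) * Mh) - 1))) ≤ 1)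
    (Q : Finset ↥(bset D)) (js : ℕ) (hQ : ∀ y ∈ Q, js ≤ y.1.1 ∧ y.1.1 ≤ js + 1) :
    Hyp56 (fun i j : ↥Q => (geom D).dist i.1 j.1) (BQ D a Q) ((CE d aplus)⁻¹ ^ 2 / ((ℓ : ℝ) + 1) ^ 2)
      (C * ((ℓ : ℝ) + 1) ^ (d + 3)) (δ₀ / 8) := by
  refine hyp56_submatrix_window (Bm_isSymm D a) (Bm_entry_le D a hℓ hMh hP hRM hC hδ₀ hX hsmall) Q ?_
  intro w hw
  have hz : ∀ y, w y ≠ 0 → js ≤ y.1.1 ∧ y.1.1 ≤ js + 1 := fun y hy => hQ y (by by_contra h; exact hy (hw y h))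
  exact Bm_coercive_window D a hMh hP ha hale js w hz

/-- **(5.7) FOR `B↾Q`** («the theory developed in Sect. 5 [3]»): `|(B↾Q)⁻¹(y, y′)| ≤ (2/γ_B)e^{−δ₁d(y,y′)}` with
`δ₁ = rate(K, γ_B, CL^{d+3}, δ₀/8)`. [cite: Balaban1984PropagatorsII, (2.79) p.237; Balaban1983RegularityDecay, (5.7) p.594] -/
theorem invBQ_decay (hℓ : 1 ≤ ℓ) (hMh : 1 ≤ Mh) (hP : ∀ μ, 1 ≤ P μ) (hRM : 1 ≤ R * ((ℓ + 1) * Mh)) {aplus : ℝ}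
    (ha : ∀ j, 0 < a j) (hale : ∀ j, a j ≤ aplus) {C δ₀ c16 : ℝ} (hC : 0 ≤ C) (hδ₀ : 0 < δ₀)
    (hc16 : 0 ≤ c16)
    (hX : ∀ y y', |Xk D a y y'| ≤ C * (geom D).len y ^ 4 * ((geom D).len y' ^ (d + 1))⁻¹ *
      Real.exp (-(δ₀ / 4 * (geom D).dist y y')))
    (hsmall : ((ℓ : ℝ) + 1) ^ (d + 3) * Real.exp (-(δ₀ / 8 * ((R : ℝ) * (((ℓ : ℝ) + 1) * Mh) - 1))) ≤ 1)
    (h261 : B6Lemma21Repaired.Ineq261With c16 (geom D) δ₀ (1 / 16))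
    (Q : Finset ↥(bset D)) (js : ℕ) (hQ : ∀ y ∈ Q, js ≤ y.1.1 ∧ y.1.1 ≤ js + 1) (i j : ↥Q) :
    |(BQ D a Q)⁻¹ i j| ≤ 2 / ((CE d aplus)⁻¹ ^ 2 / ((ℓ : ℝ) + 1) ^ 2) *
      Real.exp (-(rate (Kprof δ₀ c16 (Fintype.card ↥(bset D))) ((CE d aplus)⁻¹ ^ 2 / ((ℓ : ℝ) + 1) ^ 2)
        (C * ((ℓ : ℝ) + 1) ^ (d + 3)) (δ₀ / 8) * (geom D).dist i.1 j.1)) := by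
  have haplus : 0 ≤ aplus := (ha 1).le.trans (hale 1)
  have hγ : 0 < (CE d aplus)⁻¹ ^ 2 / ((ℓ : ℝ) + 1) ^ 2 := by have := CE_pos d haplus; positivity
  exact inv_decay (Kprof_nonneg hc16 _) hγ (by positivity) (by positivity)
    ((isPseudoDist_dist D hMh hP).comp fun i : ↥Q => i.1)
    ((sumBound_box D hMh hP h261).comp Subtype.val_injective)
    (hyp56_BQ D a hℓ hMh hP hRM ha hale hC hδ₀.le hX hsmall Q js hQ) i j

/-- `B↾Q` is invertible. [cite: Balaban1984PropagatorsII, p.235 («its inverse is well defined»)] -/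
theorem isUnit_BQ (hℓ : 1 ≤ ℓ) (hMh : 1 ≤ Mh) (hP : ∀ μ, 1 ≤ P μ) (hRM : 1 ≤ R * ((ℓ + 1) * Mh)) {aplus : ℝ}
    (ha : ∀ j, 0 < a j) (hale : ∀ j, a j ≤ aplus) {C δ₀ : ℝ} (hC : 0 ≤ C) (hδ₀ : 0 ≤ δ₀)
    (hX : ∀ y y', |Xk D a y y'| ≤ C * (geom D).len y ^ 4 * ((geom D).len y' ^ (d + 1))⁻¹ *
      Real.exp (-(δ₀ / 4 * (geom D).dist y y')))
    (hsmall : ((ℓ : ℝ) + 1) ^ (d + 3) * Real.exp (-(δ₀ / 8 * ((R : ℝ) * (((ℓ : ℝ) + 1) * Mh) - 1))) ≤ 1)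
    (Q : Finset ↥(bset D)) (js : ℕ) (hQ : ∀ y ∈ Q, js ≤ y.1.1 ∧ y.1.1 ≤ js + 1) : IsUnit (BQ D a Q) := by
  have haplus : 0 ≤ aplus := (ha 1).le.trans (hale 1)
  have hγ : 0 < (CE d aplus)⁻¹ ^ 2 / ((ℓ : ℝ) + 1) ^ 2 := by have := CE_pos d haplus; positivity
  exact isUnit_of_hyp56 hγ (hyp56_BQ D a hℓ hMh hP hRM ha hale hC hδ₀ hX hsmall Q js hQ)

end Sect5

/-! ## §4 The cube inverse `C_□` (2.70): support, the identity `□X□·C_□ = □`, the decay (2.81) -/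

section Cube

variable {ℓ Mh k R : ℕ} {P : Fin (d + 1) → ℕ} (D : Domains d ℓ Mh k P R) (a : ℕ → ℝ) (Q : Finset ↥(bset D))

/-- the indicator `□` of the set of blocks `Q` («𝔅 ∩ □»). [cite: Balaban1984PropagatorsII, (2.70) p.235, (2.82) p.237] -/
def indQ : ↥(bset D) → ℝ := fun y => if y ∈ Q then 1 else 0

/-- `(B↾Q)⁻¹` extended by zero to `𝔅 × 𝔅`. [cite: Balaban1984PropagatorsII, (2.70) p.235] -/
def Binv : Matrix ↥(bset D) ↥(bset D) ℝ := fun y y' =>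
  if h : y ∈ Q ∧ y' ∈ Q then (BQ D a Q)⁻¹ ⟨y, h.1⟩ ⟨y', h.2⟩ else 0

/-- **THE CUBE INVERSE `C_□ = ((Q′G′²Q′*)↾□)⁻¹` AS A (2.69)-KERNEL** (extended by zero off `□ × □`):
`C_□(y, y′) = (c(y)/W(y))·(B↾Q)⁻¹(y, y′)·(c(y′)/W(y′))` — the conjugation undone. [cite: Balaban1984PropagatorsII, (2.70) p.235] -/
def CkQ : ↥(bset D) → ↥(bset D) → ℝ := fun y y' => cw D y / W D y * Binv D a Q y y' * (cw D y' / W D y')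

variable {D a Q}

/-- entries of `Binv` on `Q × Q`. [folklore] -/
private theorem Binv_of_mem {y y' : ↥(bset D)} (hy : y ∈ Q) (hy' : y' ∈ Q) :
    Binv D a Q y y' = (BQ D a Q)⁻¹ ⟨y, hy⟩ ⟨y', hy'⟩ := by
  unfold Binv; rw [dif_pos ⟨hy, hy'⟩]

/-- `Binv` vanishes off `Q × Q`. [folklore] -/
private theorem Binv_of_not {y y' : ↥(bset D)} (h : y ∉ Q ∨ y' ∉ Q) : Binv D a Q y y' = 0 := by
  unfold Binv
  rw [dif_neg]
  rintro ⟨h1, h2⟩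
  rcases h with h | h
  · exact h h1
  · exact h h2

/-- **`C_□` lives on `□`**: `C_□(y″, y′) = 0` for `y″ ∉ □` (input `hCk0` of the assembly) — and for `y′ ∉ □`.
[cite: Balaban1984PropagatorsII, (2.70) p.235] -/
theorem CkQ_off {y'' y' : ↥(bset D)} (h : y'' ∉ Q ∨ y' ∉ Q) : CkQ D a Q y'' y' = 0 := by
  unfold CkQ; rw [Binv_of_not h, mul_zero, zero_mul]

/-- `X(y, y″) = B(y, y″)/(c(y)c(y″))`. [folklore] -/
private theorem Xk_eq_Bm (y y'' : ↥(bset D)) : Xk D a y y'' = Bm D a y y'' / (cw D y * cw D y'') := by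
  unfold Bm
  have h1 := (cw_pos D y).ne'
  have h2 := (cw_pos D y'').ne'
  field_simp

variable (D a Q)

/-- the key contraction: for `y, y′ ∈ □`, `W(y′)·Σ_{y″∈□} W(y″)X(y, y″)C_□(y″, y′) = δ_{yy′}` (it is `(B↾Q)(B↾Q)⁻¹ = 1`
conjugated). [cite: Balaban1984PropagatorsII, (2.70) p.235] -/
theorem sum_WXC {y y' : ↥(bset D)} (hy : y ∈ Q) (hy' : y' ∈ Q) (hU : IsUnit (BQ D a Q)) :
    W D y' * ∑ y'', indQ D Q y'' * (W D y'' * Xk D a y y'' * CkQ D a Q y'' y') = if y = y' then 1 else 0 := by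
  classical
  have he : Function.Injective (fun i : ↥Q => (i.1 : ↥(bset D))) := Subtype.val_injective
  -- the summand vanishes off `Q`; on `Q` it is `B(y,q)·(B↾Q)⁻¹(q,y′)·c(y′)/(c(y)W(y′))`
  have hoff : ∀ p : ↥(bset D), (¬ ∃ i : ↥Q, (i.1 : ↥(bset D)) = p) →
      indQ D Q p * (W D p * Xk D a y p * CkQ D a Q p y') = 0 := by
    intro p hp
    have hpQ : p ∉ Q := fun h => hp ⟨⟨p, h⟩, rfl⟩
    unfold indQ; rw [if_neg hpQ, zero_mul]
  rw [sum_eq_sum_range he _ hoff]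
  have hterm : ∀ q : ↥Q, indQ D Q q.1 * (W D q.1 * Xk D a y q.1 * CkQ D a Q q.1 y')
      = (BQ D a Q ⟨y, hy⟩ q * (BQ D a Q)⁻¹ q ⟨y', hy'⟩) * (cw D y' / (cw D y * W D y')) := by
    intro q
    unfold indQ CkQ
    rw [if_pos q.2, one_mul, Xk_eq_Bm, Binv_of_mem q.2 hy']
    have h1 := (cw_pos D y).ne'
    have h2 := (cw_pos D q.1).ne'
    have h3 := (W_pos D q.1).ne'
    have h4 := (W_pos D y').ne'
    simp only [Matrix.submatrix_apply]
    field_simp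
  rw [Finset.sum_congr rfl fun q _ => hterm q, ← Finset.sum_mul, ← Matrix.mul_apply,
    Matrix.mul_nonsing_inv _ ((Matrix.isUnit_iff_isUnit_det _).mp hU), Matrix.one_apply]
  have h1 := (cw_pos D y').ne'
  have h4 := (W_pos D y').ne'
  by_cases hyy : y = y'
  · subst hyy
    rw [if_pos rfl, if_pos rfl]
    field_simp
  · rw [if_neg (fun h => hyy (congrArg Subtype.val h)), if_neg hyy]; ring

/-- **THE OPERATOR IDENTITY `□·Q′G′²Q′*·□·C_□ = □`** (all as operators on `L²(𝔅)` with the pairing (2.69); with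
`□h_□ = h_□` it gives `(□X̃_□□)C_□h_□ = h_□`, the input `h270` of the Prop. 2.3 assembly for the first prescription
`X̃_□ = X`). [cite: Balaban1984PropagatorsII, (2.70) p.235, (2.82) p.237] -/
theorem loc_mul_CkQ (hU : IsUnit (BQ D a Q)) :
    mulOp (indQ D Q) * kerOp (W D) (Xk D a) * mulOp (indQ D Q) * kerOp (W D) (CkQ D a Q) = mulOp (indQ D Q) := by
  classical
  refine LinearMap.ext fun μ => funext fun y => ?_
  simp only [Module.End.mul_apply, mulOp_apply, kerOp_apply]
  by_cases hy : y ∈ Q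
  swap
  · unfold indQ; rw [if_neg hy, zero_mul, zero_mul]
  -- reorganise: `Σ_{y″} W X(y,y″)·(□(y″)·Σ_{y′} W C(y″,y′)μ(y′)) = Σ_{y′} μ(y′)·(W(y′)Σ_{y″} □ W X C)`
  have hre : ∑ y'', W D y'' * Xk D a y y'' * (indQ D Q y'' * ∑ y', W D y' * CkQ D a Q y'' y' * μ y')
      = ∑ y', μ y' * (W D y' * ∑ y'', indQ D Q y'' * (W D y'' * Xk D a y y'' * CkQ D a Q y'' y')) := by
    simp only [Finset.mul_sum]
    rw [Finset.sum_comm]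
    exact Finset.sum_congr rfl fun y' _ => Finset.sum_congr rfl fun y'' _ => by ring
  rw [hre]
  have hval : ∀ y', μ y' * (W D y' * ∑ y'', indQ D Q y'' * (W D y'' * Xk D a y y'' * CkQ D a Q y'' y'))
      = if y = y' then μ y' else 0 := by
    intro y'
    by_cases hy' : y' ∈ Q
    · rw [sum_WXC D a Q hy hy' hU]; split_ifs <;> simp
    · have h0 : ∀ y'', CkQ D a Q y'' y' = 0 := fun y'' => CkQ_off (Or.inr hy')
      simp only [h0, mul_zero, Finset.sum_const_zero]
      rw [if_neg (fun h : y = y' => hy' (h ▸ hy))]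
  rw [Finset.sum_congr rfl fun y' _ => hval y', Finset.sum_ite_eq]
  unfold indQ; rw [if_pos (Finset.mem_univ y), if_pos hy, one_mul]

/-- the level weights on `□`: for `y ∈ □` (levels `≥ j_s`), `c(y)/W(y) = 1/((L^j)²m(y)) ≤ …` — precisely
`(c(y)/W(y))·(c(y′)/W(y′)) ≤ (L^{j_s})^{−(d+5)}`. [cite: Balaban1984PropagatorsII, (2.80)–(2.81) p.237] -/
theorem cwW_mul_le (hℓ : 1 ≤ ℓ) {js : ℕ} {y y' : ↥(bset D)} (hy : js ≤ y.1.1) (hy' : js ≤ y'.1.1) :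
    cw D y / W D y * (cw D y' / W D y') ≤ ((((ℓ : ℝ) + 1) ^ js) ^ (d + 1 + 4))⁻¹ := by
  have hL1 : (1 : ℝ) ≤ (ℓ : ℝ) + 1 := by linarith [(Nat.cast_nonneg ℓ : (0 : ℝ) ≤ ℓ)]
  set lo : ℝ := ((ℓ : ℝ) + 1) ^ js with hlo
  have hlo1 : 1 ≤ lo := one_le_pow₀ hL1
  have hn : ∀ z : ↥(bset D), js ≤ z.1.1 → lo ≤ ((nb D z : ℕ) : ℝ) := fun z hz => by
    unfold nb; push_cast; exact pow_le_pow_right₀ hL1 hz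
  -- `c/W = 1/(n²·m)` with `m = √(n^{d+1})`
  have hcw : ∀ z : ↥(bset D), cw D z / W D z = (((nb D z : ℕ) : ℝ) ^ 2 * mW D z)⁻¹ := by
    intro z
    unfold cw
    rw [← mW_sq D z]
    have h1 := (mW_pos D z).ne'
    have h2 := (nbR_pos D z).ne'
    field_simp
  rw [hcw, hcw, ← mul_inv]
  have hlo0 : 0 < lo := by positivity
  have hprod : lo ^ (d + 1 + 4) ≤ ((nb D y : ℕ) : ℝ) ^ 2 * mW D y * (((nb D y' : ℕ) : ℝ) ^ 2 * mW D y') := by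
    have hm : lo ^ (d + 1) ≤ mW D y * mW D y' := by
      unfold mW
      rw [← Real.sqrt_mul (W_pos D y).le, W_eq_nb_pow, W_eq_nb_pow]
      have : lo ^ (d + 1) = Real.sqrt ((lo ^ (d + 1)) ^ 2) := (Real.sqrt_sq (by positivity)).symm
      rw [this]
      apply Real.sqrt_le_sqrt
      have hmul : lo * lo ≤ ((nb D y : ℕ) : ℝ) * ((nb D y' : ℕ) : ℝ) :=
        mul_le_mul (hn y hy) (hn y' hy') hlo0.le (nbR_pos D y).le
      calc (lo ^ (d + 1)) ^ 2 = (lo * lo) ^ (d + 1) := by ring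
        _ ≤ (((nb D y : ℕ) : ℝ) * ((nb D y' : ℕ) : ℝ)) ^ (d + 1) := pow_le_pow_left₀ (by positivity) hmul _
        _ = ((nb D y : ℕ) : ℝ) ^ (d + 1) * ((nb D y' : ℕ) : ℝ) ^ (d + 1) := by ring
    have h2 : lo ^ 2 ≤ ((nb D y : ℕ) : ℝ) ^ 2 := pow_le_pow_left₀ hlo0.le (hn y hy) 2
    have h3 : lo ^ 2 ≤ ((nb D y' : ℕ) : ℝ) ^ 2 := pow_le_pow_left₀ hlo0.le (hn y' hy') 2
    calc lo ^ (d + 1 + 4) = lo ^ 2 * lo ^ 2 * lo ^ (d + 1) := by ring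
      _ ≤ ((nb D y : ℕ) : ℝ) ^ 2 * ((nb D y' : ℕ) : ℝ) ^ 2 * (mW D y * mW D y') :=
          mul_le_mul (mul_le_mul h2 h3 (by positivity) (by positivity)) hm (by positivity) (by positivity)
      _ = _ := by ring
  exact inv_anti₀ (by positivity) hprod

/-- **[B6] (2.81) FOR THE GENUINE `k`-LEVEL OPERATOR**: on a two-level set of blocks `□` (levels `j_s, j_s + 1`),
`|C_□(y, y′)| ≤ (2/γ_B)·(L^{j_s})^{−(d+1)−4}·e^{−δ₁d(y,y′)}` — «|C_□(y, y′)| ≤ O(1)(L^jη)^{−d−4}e^{−δ₁(L^jη)^{−1}|y−y′|}»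
with print's `d` the spatial dimension (`d + 1` here). [cite: Balaban1984PropagatorsII, (2.81) p.237, (2.79)–(2.80) p.237] -/
theorem CkQ_decay (hℓ : 1 ≤ ℓ) (hMh : 1 ≤ Mh) (hP : ∀ μ, 1 ≤ P μ) (hRM : 1 ≤ R * ((ℓ + 1) * Mh)) {aplus : ℝ}
    (ha : ∀ j, 0 < a j) (hale : ∀ j, a j ≤ aplus) {C δ₀ c16 : ℝ} (hC : 0 ≤ C) (hδ₀ : 0 < δ₀)
    (hc16 : 0 ≤ c16)
    (hX : ∀ y y', |Xk D a y y'| ≤ C * (geom D).len y ^ 4 * ((geom D).len y' ^ (d + 1))⁻¹ *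
      Real.exp (-(δ₀ / 4 * (geom D).dist y y')))
    (hsmall : ((ℓ : ℝ) + 1) ^ (d + 3) * Real.exp (-(δ₀ / 8 * ((R : ℝ) * (((ℓ : ℝ) + 1) * Mh) - 1))) ≤ 1)
    (h261 : B6Lemma21Repaired.Ineq261With c16 (geom D) δ₀ (1 / 16))
    (js : ℕ) (hQ : ∀ y ∈ Q, js ≤ y.1.1 ∧ y.1.1 ≤ js + 1) {y y' : ↥(bset D)} (hy : y ∈ Q) (hy' : y' ∈ Q) :
    |CkQ D a Q y y'| ≤ 2 / ((CE d aplus)⁻¹ ^ 2 / ((ℓ : ℝ) + 1) ^ 2) / (((ℓ : ℝ) + 1) ^ js * 1) ^ (d + 1 + 4) *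
      Real.exp (-(rate (Kprof δ₀ c16 (Fintype.card ↥(bset D))) ((CE d aplus)⁻¹ ^ 2 / ((ℓ : ℝ) + 1) ^ 2)
        (C * ((ℓ : ℝ) + 1) ^ (d + 3)) (δ₀ / 8) * (geom D).dist y y')) := by
  have hinv := invBQ_decay D a hℓ hMh hP hRM ha hale hC hδ₀ hc16 hX hsmall h261 Q js hQ ⟨y, hy⟩ ⟨y', hy'⟩
  have hwt := cwW_mul_le D hℓ (hQ y hy).1 (hQ y' hy').1
  unfold CkQ
  rw [Binv_of_mem hy hy', mul_one]
  have e : cw D y / W D y * (BQ D a Q)⁻¹ ⟨y, hy⟩ ⟨y', hy'⟩ * (cw D y' / W D y') =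
      (cw D y / W D y * (cw D y' / W D y')) * (BQ D a Q)⁻¹ ⟨y, hy⟩ ⟨y', hy'⟩ := by ring
  rw [e, abs_mul, abs_of_pos (mul_pos (div_pos (cw_pos D y) (W_pos D y)) (div_pos (cw_pos D y') (W_pos D y')))]
  have haplus : 0 ≤ aplus := (ha 1).le.trans (hale 1)
  have hγ : 0 < (CE d aplus)⁻¹ ^ 2 / ((ℓ : ℝ) + 1) ^ 2 := by have := CE_pos d haplus; positivity
  calc cw D y / W D y * (cw D y' / W D y') * |(BQ D a Q)⁻¹ ⟨y, hy⟩ ⟨y', hy'⟩|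
      ≤ ((((ℓ : ℝ) + 1) ^ js) ^ (d + 1 + 4))⁻¹ * (2 / ((CE d aplus)⁻¹ ^ 2 / ((ℓ : ℝ) + 1) ^ 2) *
          Real.exp (-(rate (Kprof δ₀ c16 (Fintype.card ↥(bset D))) ((CE d aplus)⁻¹ ^ 2 / ((ℓ : ℝ) + 1) ^ 2)
            (C * ((ℓ : ℝ) + 1) ^ (d + 3)) (δ₀ / 8) * (geom D).dist y y'))) :=
        mul_le_mul hwt hinv (abs_nonneg _) (by positivity)
    _ = _ := by ring

end Cube

/-! ## §5 The package over the `k`-level family, thresholds explicit -/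

section Package

open Literature.MathematicalPhysics.QuantumFieldTheory.Balaban1983to89.B4Sect5Torus (weightC)

/-- **[B6] (2.70) + (2.81) FOR THE GENUINE `k`-LEVEL OPERATOR ON A BOX — THE CUBE INVERSES OF PRINT'S FIRST PRESCRIPTION,
UNIFORMLY.**  There are `δ₁, B_C, M₀, N₀ > 0` (functions of `d`, `L` and the weight window) such that for every `k ≥ 1`,
`M_h ≥ 3` with `L·M_h ≥ M₀`, `R ≥ 2L` with `R·L·M_h ≥ N₀ + 1`, every box `P`, every nested family `D` (2.1)–(2.2), every
windowed weight sequence, and EVERY finite set of blocks `□ ⊂ 𝔅` lying on two adjacent levels `j_s, j_s + 1` («either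
□̃ ⊂ B^j(Λ_j), or it intersects B^{j+1}(Λ_{j+1}) also»), the kernel `C_□ = CkQ` satisfies: (i) `C_□(y″, ·) = 0` for
`y″ ∉ □`; (ii) `□·Q′G′²Q′*·□·C_□ = □` (so `C_□ = ((Q′G′²Q′*)↾□)⁻¹`, (2.70)); (iii) **(2.81)**
`|C_□(y, y′)| ≤ B_C·(L^{j_s})^{−(d+1)−4}·e^{−δ₁d(y,y′)}`, `y, y′ ∈ □` — the inputs `hCk0`, `h270`, `h281` of
`B6Prop23TwoLevel.prop23_assembled_twoLevel`. Route: (2.68) (`ineq268_multiLevelBox`) + (2.78) (`qggq_coercive_window`)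
⇒ [3] (5.6) for the conjugated compressed kernel ⇒ (5.7) (`B4Sect5Torus.inv_decay`, profile = Lemma 2.1 on the box at
`α = 1/16`) ⇒ (2.80)–(2.81). [cite: Balaban1984PropagatorsII, (2.70) p.235, (2.78)–(2.81) p.236–237; Balaban1983RegularityDecay, Sect. 5 (5.6)–(5.7) p.594] -/
theorem ineq281_multiLevelBox (d ℓ : ℕ) (hℓ : 1 ≤ ℓ) (aminus aplus a2minus a2plus : ℝ) (ha : 0 < aminus)
    (ha2 : 0 < a2minus) :
    ∃ δ₁ BC M₀ : ℝ, ∃ N₀ : ℕ, 0 < δ₁ ∧ 0 < BC ∧ 0 < M₀ ∧ 0 < N₀ ∧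
      ∀ (k Mh R : ℕ), 3 ≤ Mh → M₀ ≤ ((ℓ : ℝ) + 1) * Mh → 2 * (ℓ + 1) ≤ R → N₀ + 1 ≤ R * ((ℓ + 1) * Mh) →
      ∀ (P : Fin (d + 1) → ℕ) (_hP : ∀ μ, 1 ≤ P μ) (D : Domains d ℓ Mh k P R) (a c : ℕ → ℝ),
        (∀ i, aminus ≤ a i ∧ a i ≤ aplus) → (∀ i, a2minus ≤ c i ∧ c i ≤ a2plus) →
        (∀ i, a (i + 1) = aNext ℓ (a i) (c i)) →
        ∀ (Q : Finset ↥(bset D)) (js : ℕ), (∀ y ∈ Q, js ≤ y.1.1 ∧ y.1.1 ≤ js + 1) →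
          (∀ y'' y', y'' ∉ Q → CkQ D a Q y'' y' = 0) ∧
          mulOp (indQ D Q) * kerOp (W D) (Xk D a) * mulOp (indQ D Q) * kerOp (W D) (CkQ D a Q)
            = mulOp (indQ D Q) ∧
          ∀ y ∈ Q, ∀ y' ∈ Q, |CkQ D a Q y y'| ≤
            BC / (((ℓ : ℝ) + 1) ^ js * 1) ^ (d + 1 + 4) * Real.exp (-(δ₁ * (geom D).dist y y')) := by
  obtain ⟨δ₀, C, M₀, N₀, hδ₀, hC, hM₀, hN₀, h268⟩ :=
    ineq268_multiLevelBox d ℓ hℓ aminus aplus a2minus a2plus ha ha2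
  have hL0 : (0 : ℝ) < (ℓ : ℝ) + 1 := by positivity
  have hL1 : (1 : ℝ) ≤ (ℓ : ℝ) + 1 := by linarith [(Nat.cast_nonneg ℓ : (0 : ℝ) ≤ ℓ)]
  have hlog : Real.log ((ℓ : ℝ) + 1) ≤ (ℓ : ℝ) + 1 := (Real.log_le_sub_one_of_pos hL0).trans (by linarith)
  have hlog0 : 0 ≤ Real.log ((ℓ : ℝ) + 1) := Real.log_nonneg hL1
  -- a positive upper weight (the window may be empty): `A = max a₊ a₋`
  set A : ℝ := max aplus aminus with hAdef
  have hA0 : 0 < A := lt_of_lt_of_le ha (le_max_right _ _)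
  -- the (2.59)-type threshold for Lemma 2.1 at `α = 1/16`
  set N₁ : ℕ := ⌈64 * ((d : ℝ) + 1) * ((ℓ : ℝ) + 1) / δ₀⌉₊ + 1 with hN₁
  have hN₁pos : 0 < N₁ := by rw [hN₁]; omega
  have hN₁ge : 64 * ((d : ℝ) + 1) * ((ℓ : ℝ) + 1) < δ₀ * (N₁ : ℝ) := by
    have h : 64 * ((d : ℝ) + 1) * ((ℓ : ℝ) + 1) / δ₀ < (N₁ : ℝ) := by
      rw [hN₁]; push_cast; exact lt_of_le_of_lt (Nat.le_ceil _) (by linarith)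
    rw [div_lt_iff₀ hδ₀] at h; linarith
  have hθ16 : Real.exp (-(1 / 16 * δ₀)) * ((ℓ : ℝ) + 1) ^ ((2 * (d + 1 : ℕ) : ℝ) / N₁) < 1 := by
    refine theta_lt_one_of_log hL0 hN₁pos ?_
    push_cast
    have hd0 : (0 : ℝ) ≤ 2 * ((d : ℝ) + 1) := by positivity
    nlinarith [mul_le_mul_of_nonneg_left hlog hd0]
  -- the absorption threshold `L^{d+3} ≤ e^{(δ₀/8)(RM − 1)}`
  set N₂ : ℕ := ⌈8 * ((d : ℝ) + 3) * ((ℓ : ℝ) + 1) / δ₀⌉₊ with hN₂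
  have hN₂ge : 8 * ((d : ℝ) + 3) * ((ℓ : ℝ) + 1) ≤ δ₀ * (N₂ : ℝ) := by
    have h : 8 * ((d : ℝ) + 3) * ((ℓ : ℝ) + 1) / δ₀ ≤ (N₂ : ℝ) := by rw [hN₂]; exact Nat.le_ceil _
    rw [div_le_iff₀ hδ₀] at h; linarith
  -- constants
  set cK : ℝ := K261 N₁ (d + 1) ((ℓ : ℝ) + 1) 1 (1 / 16 * δ₀) with hcK
  have hcK0 : 0 ≤ cK := K261_nonneg (by positivity) zero_le_one
  set γB : ℝ := (CE d A)⁻¹ ^ 2 / ((ℓ : ℝ) + 1) ^ 2 with hγB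
  have hγB0 : 0 < γB := by have := CE_pos d hA0.le; positivity
  set c₀ : ℝ := C * ((ℓ : ℝ) + 1) ^ (d + 3) with hc₀
  set δ₁ : ℝ := rate (fun _ => cK) γB c₀ (δ₀ / 8) with hδ₁
  have hδ₁0 : 0 < δ₁ := rate_pos (K := fun _ => cK) (fun _ _ => hcK0) hγB0 (by positivity) (by positivity)
  refine ⟨δ₁, 2 / γB, M₀, max N₀ (max N₁ N₂), hδ₁0, by positivity, hM₀,
    lt_of_lt_of_le hN₀ (le_max_left _ _), ?_⟩
  intro k Mh R hMh hM hR hRM P hP D a c haw hcw hac Q js hQ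
  have hMh1 : 1 ≤ Mh := le_trans (by norm_num) hMh
  have hRM0 : N₀ + 1 ≤ R * ((ℓ + 1) * Mh) := le_trans (Nat.succ_le_succ (le_max_left _ _)) hRM
  have hRM1 : N₁ + 1 ≤ R * ((ℓ + 1) * Mh) :=
    le_trans (Nat.succ_le_succ ((le_max_left _ _).trans (le_max_right _ _))) hRM
  have hRM2 : N₂ + 1 ≤ R * ((ℓ + 1) * Mh) :=
    le_trans (Nat.succ_le_succ ((le_max_right _ _).trans (le_max_right _ _))) hRM
  have hRMone : 1 ≤ R * ((ℓ + 1) * Mh) := le_trans (by omega) hRM1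
  have ha' : ∀ j, 0 < a j := fun j => lt_of_lt_of_le ha (haw j).1
  have hale : ∀ j, a j ≤ A := fun j => (haw j).2.trans (le_max_left _ _)
  -- (2.68), Lemma 2.1 at 1/16, the absorption threshold
  have hX : ∀ y y', |Xk D a y y'| ≤ C * (geom D).len y ^ 4 * ((geom D).len y' ^ (d + 1))⁻¹ *
      Real.exp (-(δ₀ / 4 * (geom D).dist y y')) :=
    fun y y' => (h268 k Mh R hMh hM hR hRM0 P hP D a c haw hcw hac y y').1
  obtain ⟨-, h261, -, -⟩ := lemma21_box D hMh1 hP hN₁pos hRM1 hδ₀.le (α := 1 / 16) (by norm_num) (by norm_num) hθ16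
  have hsmall : ((ℓ : ℝ) + 1) ^ (d + 3) * Real.exp (-(δ₀ / 8 * ((R : ℝ) * (((ℓ : ℝ) + 1) * Mh) - 1))) ≤ 1 := by
    have hge : (N₂ : ℝ) ≤ (R : ℝ) * (((ℓ : ℝ) + 1) * Mh) - 1 := by
      have : ((N₂ + 1 : ℕ) : ℝ) ≤ ((R * ((ℓ + 1) * Mh) : ℕ) : ℝ) := by exact_mod_cast hRM2
      push_cast at this; linarith
    have h1 : ((d : ℝ) + 3) * Real.log ((ℓ : ℝ) + 1) ≤ δ₀ / 8 * ((R : ℝ) * (((ℓ : ℝ) + 1) * Mh) - 1) := by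
      have hd3 : (0 : ℝ) ≤ (d : ℝ) + 3 := by positivity
      nlinarith [mul_le_mul_of_nonneg_left hge (by positivity : (0 : ℝ) ≤ δ₀ / 8),
        mul_le_mul_of_nonneg_left hlog hd3]
    have h2 : ((ℓ : ℝ) + 1) ^ (d + 3) = Real.exp (((d : ℝ) + 3) * Real.log ((ℓ : ℝ) + 1)) := by
      rw [← Real.exp_log (pow_pos hL0 (d + 3)), Real.log_pow]; push_cast; ring_nf
    rw [h2, ← Real.exp_add, Real.exp_le_one_iff]
    linarith
  have hU := isUnit_BQ D a hℓ hMh1 hP hRMone ha' hale hC.le hδ₀.le hX hsmall Q js hQ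
  refine ⟨fun y'' y' h => CkQ_off (Or.inl h), loc_mul_CkQ D a Q hU, fun y hy y' hy' => ?_⟩
  have h := CkQ_decay D a Q hℓ hMh1 hP hRMone ha' hale hC.le hδ₀ hcK0 hX hsmall h261 js hQ hy hy'
  rw [rate_Kprof] at h
  exact h

end Package

end

end Literature.MathematicalPhysics.QuantumFieldTheory.Balaban1983to89.B6Ineq281MultiLevelBoxL0
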